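import Summits.BirchSwinnertonDyer.Rank1Residual.X11b.AnticyclotomicLowerLinks
import Summits.BirchSwinnertonDyer.Rank1Residual.X11b.CharIdealTrivialCharacter
import Literature.NumberTheory.EllipticCurves.BDPAnticyclotomicPAdicLFunction
import HarnessLib

/-!
# X11b, S10 HALVES (every prime `p`): the receptacle `R₀ ⊂ ℂ_p` and the POINTWISE refinement of
# S0's binder — `CTL₀ ∧ (Ch_Λ(X_ac)·R₀⟦T⟧ ⊆ (L)) ∧ (L(0) = u·((1 − a/p)·log_ω P)²) ⟹
# IMCLowerWaldspurgerOnTreeAt p κ 𝔭 γ ι P`, in the NORM currency of `ℂ_p`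

HONEST FRAMING (cell `b2b-bsdres`, run/shared/lean/b2b/bsd-rank1-residual/, verbatim in every
file): the goal of the cell is to DELETE the COMBINATION-SHAPED residual classes of the
Birch–Swinnerton-Dyer formula for ALL analytic-rank `≤ 1` elliptic curves over `ℚ` — "full BSD
formula for every rank `≤ 1` curve in class `C`" assembled STRICTLY from published theorems — so
that the rank-`≤ 1` remainder becomes exactly the CONSTRUCTION-SHAPED classes, which are TYPED
(missing-input `Prop`s), NOT attempted. This is not "finishing BSD". Team `x11b3` = N8/O2 (X11b at
`p = 3`: `3 ‖ N`, `r_an = 1`, `E[3]` irreducible): RESEARCH ROUTES; published theorems only; the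
construction-shaped remainder is TYPED, not attempted; census output = EVIDENCE, never a Literature
fact; nothing booked; no label change; O2 stays OPEN; no route opened.

PROVENANCE (team `cells/x11b3/`, sub-target S10 · HALVES@3, LEAD DEALS #4–#6): statements and proofs
of this file are route planner 2's kernel-checked sketch `HOME/b2b-bsdres-x11b3-r2/HalvesSketchR2.lean`
(sha16 296bb72c4ec76f27, §1–§2), reviewed by route planner 1 (LINE-W.md W0 ADDENDUM 2, checklist
R-a…R-m, signature of record v1.9h); ported VERBATIM and filed by seat `b2b-bsdres-x11b3-p7` (gen. 2)
as PROXY for the S10 owner `b2b-bsdres-x11b3-p9`. This half of the port is the GENERAL-`p` part and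
lives OUTSIDE `X11b/Three/` (namespace `…X11b.Halves`) so that route R1's `p ≥ 5` halves
(`X11b/RouteR1Halves.lean`, seat multr1-p1) can import it without importing any `Three` module
(OWNERS A6.3 (2) namespace treaty). It declares NO general-`p` hypothesis SHAPE (those are route R1's
under `X11b.R1.` and x11b3's `₃`-specialised ones in `X11b/Three/StepLHalves.lean`): only THEOREMS and
two plain definitions (`toUnr`, `logOmega`).

## What is kernel-checked here (THEOREMS + two definitions; no fact, no hypothesis shape, no placeholder)

S0's binder of record is `IMCLowerWaldspurgerOnTreeAt p κ 𝔭 γ ι P :=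
∃ n, XAc.HasCharValuationAt (E/K) p κ 𝔭 ∅ γ n ∧ 2·(padicLogOrd E p ι P − 1) ≤ n`
(`X11b/AnticyclotomicLowerLinks.lean`). This file proves the pure algebra that feeds it from the
printed halves:
* §1 the receptacle `R₀ = unrIntegers p ⊂ ℂ_p` (Literature `BDPAnticyclotomicPAdicLFunction.lean`):
  `R₀ ⊆ {‖·‖ ≤ 1}`, `‖u‖ = 1` for `u ∈ R₀ˣ`, `ℤ_p ⊆ R₀` (`toUnr : ℤ_[p] →+* unrIntegers p`, by density
  of `ℤ` and closedness of `R₀`), `‖1 − a·p⁻¹‖ ≤ p` (and `= p` for `a = ±1`, R-d), and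
  **`two_mul_sub_one_le_valuation`**: if `f ∈ ℤ_p⟦T⟧` has `f(0) ≠ 0`, `f ↦ G·L` in `R₀⟦T⟧` and
  `L(0) = u·((1 − a/p)·x)²`, then `x ≠ 0` and `2·(ord_p x − 1) ≤ ord_p f(0)` — by NORMS in `ℂ_p`
  (`‖G(0)‖ ≤ 1`, `‖u‖ = 1`, `‖1 − a/p‖ ≤ p`), so NO integer `ord` on `ℂ_p` and NO DVR structure on
  `R₀` is needed (R-j), and `x ≠ 0` is a CONSEQUENCE of `f(0) ≠ 0`, not a binder; anti-vacuity
  (R-g): `constantCoeff_ne_zero_of_hasValueAt`, `bdpValueShape_ne_zero`;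
* §2 `logOmega W p ι P ∈ ℚ_p` (`log_{ω_E} P`, the quantity whose `ord_p` is `padicLogOrd`),
  `valuation_logOmega`, and the pointwise assembly **`imcLowerWaldspurgerOnTreeAt_of_value_of_dvd`**:
  `HasCharValuationAt … n` ∧ `(Ch_Λ X_ac).map (PowerSeries.map (toUnr p)) ≤ Ideal.span {L}` ∧
  `L.HasValueAt 0 (u·((1 − a/p)·logOmega)²)` ⟹ `IMCLowerWaldspurgerOnTreeAt p κ 𝔭 γ ι P` with the
  SAME `n` (every `p`, every `a : ℤ`, every embedding `ι : K →+* ℚ_p`); and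
  `exists_hasCharValuationAt_of_controlOnTreeAt` (CTL₀ ⟸ the tree's full control identity).

## What this does NOT do
It asserts nothing about elliptic curves beyond algebra: no BDP `L`-function is constructed, no
value formula or divisibility is claimed (those are the TYPED inputs H1/H2/H3 of
`X11b/Three/StepLHalves.lean` at `p = 3`, and route R1's at `p ≥ 5`). Nothing is booked; no label
changes; O2 stays OPEN.

References: [Castella2018] Thm. 2.3, Thm. 3.2, §5 (arXiv:1704.06608 pp. 5, 8–9, 12) (the shapes the
algebra serves); [CastellaHsieh2018] §3.3; review checklist R-a…R-m (x11b3-r1, `cells/x11b3/LINE-W.md`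
W0 ADDENDUM 2); `HOME/b2b-bsdres-lit-cw/CASTELLA-WAN.md` §14 (period coherence).
-/

noncomputable section

open scoped Classical

open WeierstrassCurve NumberField IsDedekindDomain Field PowerSeries
  Literature.NumberTheory.EllipticCurves
  Literature.NumberTheory.EllipticCurves.Rank1Residual
  Summit.BirchSwinnertonDyer.Rank1Residual.X11b.AcSelmer
  Summit.BirchSwinnertonDyer.Rank1Residual.X11b.CongruenceLimit

namespace Summit.BirchSwinnertonDyer.Rank1Residual.X11b.Halves

universe u

/-! ## §1 The receptacle `R₀ ⊂ ℂ_p`: norm facts and `ℤ_p ⊆ R₀` (every prime `p`) -/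

section Receptacle

variable (p : ℕ) [Fact p.Prime]

/-- `R₀ ⊆ {x ∈ ℂ_p : ‖x‖ ≤ 1}`: prime-to-`p` roots of unity have norm `1`, the closed unit ball is a
closed subring. [folklore] -/
theorem norm_le_one_of_mem_unrIntegers {x : ℂ_[p]} (hx : x ∈ unrIntegers p) : ‖x‖ ≤ 1 := by
  let O : Subring ℂ_[p] := (NormedField.valuation (K := ℂ_[p])).integer
  have hO : ∀ y : ℂ_[p], y ∈ O ↔ ‖y‖ ≤ 1 := fun y ↦ by
    rw [Valuation.mem_integer_iff, NormedField.valuation_apply, ← NNReal.coe_le_coe, coe_nnnorm,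
      NNReal.coe_one]
  have hcl : IsClosed (O : Set ℂ_[p]) := by
    have hball : (O : Set ℂ_[p]) = Metric.closedBall 0 1 := by
      ext y
      rw [SetLike.mem_coe, hO, Metric.mem_closedBall, dist_zero_right]
    rw [hball]
    exact Metric.isClosed_closedBall
  have hle : unrIntegers p ≤ O := by
    refine Subring.topologicalClosure_minimal _ (Subring.closure_le.mpr ?_) hcl
    rintro ζ ⟨m, hm, -, hζ⟩
    rw [SetLike.mem_coe, hO]
    have h : ‖ζ‖ ^ m = 1 := by rw [← norm_pow, hζ, norm_one]
    exact ((pow_eq_one_iff_of_nonneg (norm_nonneg ζ) hm.ne').mp h).le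
  exact (hO x).mp (hle hx)

/-- Elements of `R₀` have norm `≤ 1`. [folklore] -/
theorem norm_coe_unrIntegers_le_one (x : unrIntegers p) : ‖(x : ℂ_[p])‖ ≤ 1 :=
  norm_le_one_of_mem_unrIntegers p x.2

/-- Units of `R₀` have norm exactly `1` (`‖u‖·‖u⁻¹‖ = 1`, both `≤ 1`). [folklore] -/
theorem norm_coe_units_unrIntegers (u : (unrIntegers p)ˣ) : ‖((u : unrIntegers p) : ℂ_[p])‖ = 1 := by
  refine le_antisymm (norm_coe_unrIntegers_le_one p _) ?_
  have h1 : ‖((u : unrIntegers p) : ℂ_[p])‖ * ‖(((u⁻¹ : (unrIntegers p)ˣ) : unrIntegers p) : ℂ_[p])‖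
      = 1 := by
    rw [← norm_mul, ← Subring.coe_mul, Units.mul_inv, Subring.coe_one, norm_one]
  calc (1 : ℝ) = ‖((u : unrIntegers p) : ℂ_[p])‖ *
        ‖(((u⁻¹ : (unrIntegers p)ˣ) : unrIntegers p) : ℂ_[p])‖ := h1.symm
    _ ≤ ‖((u : unrIntegers p) : ℂ_[p])‖ * 1 :=
        mul_le_mul_of_nonneg_left (norm_coe_unrIntegers_le_one p _) (norm_nonneg _)
    _ = ‖((u : unrIntegers p) : ℂ_[p])‖ := mul_one _

/-- `ℤ_p ⊆ R₀` inside `ℂ_p`: `ℤ` is dense in `ℤ_p`, `ℤ ⊆ R₀`, and `R₀` is closed. [folklore] -/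
theorem algebraMap_coe_padicInt_mem_unrIntegers (x : ℤ_[p]) :
    algebraMap ℚ_[p] ℂ_[p] (x : ℚ_[p]) ∈ unrIntegers p := by
  have hc : Continuous fun y : ℤ_[p] ↦ algebraMap ℚ_[p] ℂ_[p] (y : ℚ_[p]) :=
    (continuous_algebraMap ℚ_[p] ℂ_[p]).comp continuous_subtype_val
  have hx : x ∈ closure (Set.range (Int.cast : ℤ → ℤ_[p])) := by
    rw [PadicInt.denseRange_intCast.closure_range]
    exact Set.mem_univ x
  have h := map_mem_closure (t := (unrIntegers p : Set ℂ_[p])) hc hx (by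
    rintro _ ⟨n, rfl⟩
    show algebraMap ℚ_[p] ℂ_[p] (((n : ℤ_[p]) : ℚ_[p])) ∈ unrIntegers p
    rw [PadicInt.coe_intCast, map_intCast]
    exact intCast_mem_unrIntegers n)
  rwa [(isClosed_unrIntegers (p := p)).closure_eq] at h

/-- The structure map `ℤ_p → R₀` (`R₀ = O_L`, `L/ℚ_p` the completed maximal unramified extension
contains `ℚ_p`). [folklore] -/
def toUnr : ℤ_[p] →+* unrIntegers p :=
  ((algebraMap ℚ_[p] ℂ_[p]).comp PadicInt.Coe.ringHom).codRestrict (unrIntegers p)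
    (algebraMap_coe_padicInt_mem_unrIntegers p)

/-- `toUnr p x`, seen in `ℂ_p`, is the image of `x` under `ℤ_p ⊂ ℚ_p → ℂ_p`. [folklore] -/
@[simp]
theorem coe_toUnr (x : ℤ_[p]) : ((toUnr p x : unrIntegers p) : ℂ_[p]) = algebraMap ℚ_[p] ℂ_[p] (x : ℚ_[p]) :=
  rfl

/-- `‖1 − a·p⁻¹‖ ≤ p` in `ℚ_p` for every integer `a` (non-archimedean bound; the only estimate on the
Euler-type factor the INEQUALITY of S0's binder needs). [folklore] -/
theorem norm_one_sub_div_le (a : ℤ) : ‖(1 : ℚ_[p]) - (a : ℚ_[p]) * (p : ℚ_[p])⁻¹‖ ≤ p := by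
  have hp1 : (1 : ℝ) ≤ p := by exact_mod_cast (Fact.out : p.Prime).one_lt.le
  have hp0 : (0 : ℝ) < p := by positivity
  rw [sub_eq_add_neg]
  refine (Padic.nonarchimedean _ _).trans (max_le ?_ ?_)
  · rw [norm_one]; exact hp1
  · rw [norm_neg, norm_mul, norm_inv, Padic.norm_p, inv_inv]
    calc ‖(a : ℚ_[p])‖ * (p : ℝ) ≤ 1 * p :=
          mul_le_mul_of_nonneg_right (Padic.norm_int_le_one a) hp0.le
      _ = p := one_mul _

/-- **`p`-Tamagawa/Euler-factor bookkeeping (R-d), exact form**: for `a = ±1` (the value of `a_p(E)`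
at a prime of multiplicative reduction) `‖1 − a·p⁻¹‖ = p`, i.e. `ord_p(1 − a_p p⁻¹) = −1` EXACTLY
(Cas18 proof of Thm. 3.2: "`p^{-1}(p − a_p) ∈ {(p ± 1)/p}` since `p ∣ N`"). [cite: Castella2018, proof of Thm. 3.2 (arXiv:1704.06608 p. 9)] -/
theorem norm_one_sub_div_eq {a : ℤ} (ha : a = 1 ∨ a = -1) :
    ‖(1 : ℚ_[p]) - (a : ℚ_[p]) * (p : ℚ_[p])⁻¹‖ = p := by
  have hp : (p : ℚ_[p]) ≠ 0 := by exact_mod_cast (Fact.out : p.Prime).ne_zero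
  have hrew : (1 : ℚ_[p]) - (a : ℚ_[p]) * (p : ℚ_[p])⁻¹ = (((p : ℤ) - a : ℤ) : ℚ_[p]) * (p : ℚ_[p])⁻¹ := by
    push_cast
    field_simp
  have hnd : ¬ (p : ℤ) ∣ (p : ℤ) - a := by
    intro h
    have h1 : (p : ℤ) ∣ a := by simpa [sub_sub_cancel] using dvd_sub (dvd_refl (p : ℤ)) h
    have h2 : (p : ℤ) ∣ 1 := by
      rcases ha with rfl | rfl
      · exact h1
      · simpa using h1.neg_right
    exact (Fact.out : p.Prime).ne_one (by exact_mod_cast Int.eq_one_of_dvd_one (by positivity) h2)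
  have hunit : ‖(((p : ℤ) - a : ℤ) : ℚ_[p])‖ = 1 :=
    le_antisymm (Padic.norm_int_le_one _)
      (not_lt.mp (mt Padic.norm_intCast_lt_one_iff.mp hnd))
  rw [hrew, norm_mul, norm_inv, Padic.norm_p, inv_inv, hunit, one_mul]

/-- From a real inequality between powers of `p` to the integer inequality of S0's binder. [folklore] -/
theorem two_mul_sub_one_le_of_zpow_le {n : ℕ} {v : ℤ}
    (h : (p : ℝ) ^ (-(n : ℤ)) ≤ (p : ℝ) ^ 2 * ((p : ℝ) ^ (-v)) ^ 2) : 2 * (v - 1) ≤ (n : ℤ) := by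
  have hp1 : (1 : ℝ) < p := by exact_mod_cast (Fact.out : p.Prime).one_lt
  have hp0 : (0 : ℝ) < p := by positivity
  have hrhs : (p : ℝ) ^ 2 * ((p : ℝ) ^ (-v)) ^ 2 = (p : ℝ) ^ (2 - 2 * v) := by
    rw [← zpow_natCast ((p : ℝ) ^ (-v)) 2, ← zpow_mul, ← zpow_natCast (p : ℝ) 2, ← zpow_add₀ hp0.ne']
    congr 1
    push_cast
    ring
  rw [hrhs, zpow_le_zpow_iff_right₀ hp1] at h
  omega

/-- **The algebra of HALVES (every `p`, every integer `a`).** If `f ∈ Λ = ℤ_p⟦T⟧` has non-zero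
constant term (`X_ac` torsion with `f_ac(0) ≠ 0` — control), its image in `Λ_{R₀} = R₀⟦T⟧` lies in
`(L)` (the divisibility H3), and `L(0) = u·((1 − a p⁻¹)·x)²` with `u ∈ R₀ˣ` (the value formula H2),
then `x ≠ 0` and `2·(ord_p x − 1) ≤ ord_p f(0)`. Proof by norms in `ℂ_p`:
`‖f(0)‖ = ‖G(0)‖·‖L(0)‖ ≤ ‖L(0)‖ = ‖(1 − a/p) x‖² ≤ p²‖x‖²`. No DVR structure on `R₀`, no integer
valuation on `ℂ_p`. [folklore] -/
theorem two_mul_sub_one_le_valuation {f : IwasawaAlgebra p} (hf0 : constantCoeff f ≠ 0)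
    {L : UnrSeries p} (hfL : PowerSeries.map (toUnr p) f ∈ Ideal.span {L})
    (u : (unrIntegers p)ˣ) (a : ℤ) {x : ℚ_[p]}
    (hL : L.HasValueAt 0 (((u : unrIntegers p) : ℂ_[p]) *
      (algebraMap ℚ_[p] ℂ_[p] (((1 : ℚ_[p]) - (a : ℚ_[p]) * (p : ℚ_[p])⁻¹) * x)) ^ 2)) :
    x ≠ 0 ∧ 2 * (x.valuation - 1) ≤ ((constantCoeff f).valuation : ℤ) := by
  set y : ℚ_[p] := ((1 : ℚ_[p]) - (a : ℚ_[p]) * (p : ℚ_[p])⁻¹) * x with hy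
  -- `L(0)` is the constant term
  have hL0 : ((u : unrIntegers p) : ℂ_[p]) * (algebraMap ℚ_[p] ℂ_[p] y) ^ 2 =
      ((constantCoeff L : unrIntegers p) : ℂ_[p]) :=
    UnrSeries.eq_constantCoeff_of_hasValueAt_zero hL
  -- `f ↦ G·L`
  obtain ⟨G, hG⟩ := Ideal.mem_span_singleton'.mp hfL
  have hfac : algebraMap ℚ_[p] ℂ_[p] ((constantCoeff f : ℤ_[p]) : ℚ_[p]) =
      ((constantCoeff G : unrIntegers p) : ℂ_[p]) * ((constantCoeff L : unrIntegers p) : ℂ_[p]) := by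
    rw [← coe_toUnr, ← constantCoeff_map_apply (toUnr p) f, ← hG, map_mul, Subring.coe_mul]
  -- norms
  have hp1 : (1 : ℝ) < p := by exact_mod_cast (Fact.out : p.Prime).one_lt
  have hp0 : (0 : ℝ) < p := by positivity
  have hnormf : ‖((constantCoeff f : ℤ_[p]) : ℚ_[p])‖ ≤ (p : ℝ) ^ 2 * ‖x‖ ^ 2 := by
    calc ‖((constantCoeff f : ℤ_[p]) : ℚ_[p])‖
        = ‖algebraMap ℚ_[p] ℂ_[p] ((constantCoeff f : ℤ_[p]) : ℚ_[p])‖ :=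
          (norm_algebraMap' ℂ_[p] _).symm
      _ = ‖((constantCoeff G : unrIntegers p) : ℂ_[p])‖ *
            ‖((constantCoeff L : unrIntegers p) : ℂ_[p])‖ := by rw [hfac, norm_mul]
      _ ≤ 1 * ‖((constantCoeff L : unrIntegers p) : ℂ_[p])‖ :=
          mul_le_mul_of_nonneg_right (norm_coe_unrIntegers_le_one p _) (norm_nonneg _)
      _ = ‖algebraMap ℚ_[p] ℂ_[p] y‖ ^ 2 := by
          rw [one_mul, ← hL0, norm_mul, norm_pow, norm_coe_units_unrIntegers, one_mul]
      _ = ‖y‖ ^ 2 := by rw [norm_algebraMap']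
      _ ≤ ((p : ℝ) * ‖x‖) ^ 2 := by
          refine pow_le_pow_left₀ (norm_nonneg _) ?_ 2
          rw [hy, norm_mul]
          exact mul_le_mul_of_nonneg_right (norm_one_sub_div_le p a) (norm_nonneg _)
      _ = (p : ℝ) ^ 2 * ‖x‖ ^ 2 := by ring
  -- `x ≠ 0`
  have hx0 : x ≠ 0 := by
    intro hx
    rw [hx, norm_zero, zero_pow two_ne_zero, mul_zero] at hnormf
    have h0 : ((constantCoeff f : ℤ_[p]) : ℚ_[p]) = 0 :=
      norm_eq_zero.mp (le_antisymm hnormf (norm_nonneg _))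
    exact hf0 (PadicInt.coe_eq_zero.mp h0)
  refine ⟨hx0, two_mul_sub_one_le_of_zpow_le p ?_⟩
  rwa [← PadicInt.norm_def, PadicInt.norm_eq_zpow_neg_valuation hf0,
    Padic.norm_eq_zpow_neg_valuation hx0] at hnormf

/-- **Anti-vacuity (R-g)**: a power series with a NON-ZERO value at `0` has non-zero constant term;
with H2 and `log P ≠ 0` this gives `[T⁰] L_𝔭^{BDP} ≠ 0` without assuming `X_ac` non-torsion. [folklore] -/
theorem constantCoeff_ne_zero_of_hasValueAt {L : UnrSeries p} {v : ℂ_[p]} (hL : L.HasValueAt 0 v)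
    (hv : v ≠ 0) : constantCoeff L ≠ 0 := by
  intro h0
  apply hv
  rw [UnrSeries.eq_constantCoeff_of_hasValueAt_zero hL, h0, Subring.coe_zero]

/-- The H2-value `u·((1 − a p⁻¹)·x)²` is non-zero as soon as `a ≠ p` and `x ≠ 0`. [folklore] -/
theorem bdpValueShape_ne_zero (u : (unrIntegers p)ˣ) {a : ℤ} (ha : (a : ℚ_[p]) ≠ p) {x : ℚ_[p]}
    (hx : x ≠ 0) :
    ((u : unrIntegers p) : ℂ_[p]) *
      (algebraMap ℚ_[p] ℂ_[p] (((1 : ℚ_[p]) - (a : ℚ_[p]) * (p : ℚ_[p])⁻¹) * x)) ^ 2 ≠ 0 := by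
  have hp : (p : ℚ_[p]) ≠ 0 := by exact_mod_cast (Fact.out : p.Prime).ne_zero
  have hu : ((u : unrIntegers p) : ℂ_[p]) ≠ 0 := by
    intro h
    have h1 := norm_coe_units_unrIntegers p u
    rw [h, norm_zero] at h1
    exact zero_ne_one h1
  have hfac : (1 : ℚ_[p]) - (a : ℚ_[p]) * (p : ℚ_[p])⁻¹ ≠ 0 := by
    intro h
    apply ha
    have : (a : ℚ_[p]) * (p : ℚ_[p])⁻¹ = 1 := (sub_eq_zero.mp h).symm
    calc (a : ℚ_[p]) = (a : ℚ_[p]) * (p : ℚ_[p])⁻¹ * p := by rw [inv_mul_cancel_right₀ hp]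
      _ = p := by rw [this, one_mul]
  refine mul_ne_zero hu (pow_ne_zero 2 ?_)
  rw [ne_eq, map_eq_zero_iff _ (algebraMap ℚ_[p] ℂ_[p]).injective]
  exact mul_ne_zero hfac hx

end Receptacle

/-! ## §2 The pointwise refinement of S0's binder (every `p`, every embedding `ι : K → ℚ_p`) -/

section Pointwise

variable {K : Type} [Field K] [NumberField K] (W : WeierstrassCurve ℚ) [W.IsElliptic]
  [W.IsGloballyMinimal] (p : ℕ) [Fact p.Prime] (ι : K →+* ℚ_[p]) (P : (W.baseChange K).toAffine.Point)

/-- `log_{ω_E} P ∈ ℚ_p` (Néron differential of the model `W`): `log_Ê([m] P_p)/m`, `m` the formal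
index, `P_p` the image of `P` under `ι`; the quantity whose `ord_p` is `padicLogOrd W p ι P`
(`PadicFormalLogOrder.lean`). [cite: Castella2018, Thm. 2.3 (arXiv:1704.06608 p. 5), "log_{ω_E} P ∈ ℤ_p"] -/
def logOmega : ℚ_[p] :=
  (W.baseChange ℚ_[p]).padicLogPoint (formalIndex W p • padicPointOf W p ι P) / (formalIndex W p : ℚ_[p])

variable {W p ι P} in
/-- `ord_p log_{ω_E} P = padicLogOrd W p ι P` whenever `log_{ω_E} P ≠ 0`. [folklore] -/
theorem valuation_logOmega (h : logOmega W p ι P ≠ 0) :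
    (logOmega W p ι P).valuation = padicLogOrd W p ι P := by
  unfold logOmega at h ⊢
  set A := (W.baseChange ℚ_[p]).padicLogPoint (formalIndex W p • padicPointOf W p ι P) with hA
  have hA0 : A ≠ 0 := by
    intro h0; apply h; rw [h0, zero_div]
  have hm0 : (formalIndex W p : ℚ_[p]) ≠ 0 := by
    intro h0; apply h; rw [h0, div_zero]
  rw [div_eq_mul_inv, Padic.valuation_mul hA0 (inv_ne_zero hm0), Padic.valuation_inv,
    Padic.valuation_natCast, padicLogOrd]
  ring

variable (κ : ZpExtension K p) (𝔭 : HeightOneSpectrum (𝓞 K)) (γ : absoluteGaloisGroup K)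
  [Fact (κ.IsTopGenerator γ)]

variable {W p ι P κ 𝔭 γ} in
/-- **HALVES, pointwise (every `p`)**: CTL₀ (`HasCharValuationAt … n`) ∧ H3 (`Ch_Λ(X_ac)·R₀⟦T⟧ ⊆ (L)`)
∧ H2 (`L(0) = u·((1 − a/p)·log_{ω_E} P)²`) ⟹ S0's binder `IMCLowerWaldspurgerOnTreeAt p κ 𝔭 γ ι P`
with the SAME `n`; `log_{ω_E} P ≠ 0` comes out, it is not put in. [cite: Castella2018, §5 (5.1)–(5.3) (arXiv:1704.06608 p. 12) (the assembly, as an inequality)] -/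
theorem imcLowerWaldspurgerOnTreeAt_of_value_of_dvd {n : ℕ}
    (hn : XAc.HasCharValuationAt (W.baseChange K) p κ 𝔭 ∅ γ n) {L : UnrSeries p}
    (h3 : (XAc.charIdeal (W.baseChange K) p κ 𝔭 ∅ γ).map (PowerSeries.map (toUnr p)) ≤ Ideal.span {L})
    (u : (unrIntegers p)ˣ) (a : ℤ)
    (h2 : L.HasValueAt 0 (((u : unrIntegers p) : ℂ_[p]) *
      (algebraMap ℚ_[p] ℂ_[p] (((1 : ℚ_[p]) - (a : ℚ_[p]) * (p : ℚ_[p])⁻¹) * logOmega W p ι P)) ^ 2)) :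
    IMCLowerWaldspurgerOnTreeAt p κ 𝔭 γ ι P := by
  obtain ⟨htors, f, hf, hf0, hfn⟩ := hn
  have hmem : PowerSeries.map (toUnr p) f ∈ Ideal.span {L} := by
    rw [hf, map_span_singleton_powerSeries] at h3
    exact (Ideal.span_singleton_le_iff_mem _).mp h3
  obtain ⟨hx0, hle⟩ := two_mul_sub_one_le_valuation p hf0 hmem u a h2
  refine ⟨n, ⟨htors, f, hf, hf0, hfn⟩, ?_⟩
  rw [← valuation_logOmega hx0, ← hfn]
  exact hle

/-- CTL₀ is implied by the tree's full control identity `ControlOnTreeAt` (so on the tight locus A1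
it is a THEOREM: `Three.p2ControlOnTreeAt_of_locus`). [folklore] -/
theorem exists_hasCharValuationAt_of_controlOnTreeAt (h : ControlOnTreeAt p κ 𝔭 γ ι P) :
    ∃ n : ℕ, XAc.HasCharValuationAt (W.baseChange K) p κ 𝔭 ∅ γ n := by
  obtain ⟨n, hn, -⟩ := h
  exact ⟨n, hn⟩

end Pointwise

end Summit.BirchSwinnertonDyer.Rank1Residual.X11b.Halves

end
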